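import Literature.AlgebraicGeometry.Resolution.StrictNormalCrossingsOpen
import HarnessLib

/-!
# The strict normal crossings condition is an open condition (schemes)

Topic: `Literature/AlgebraicGeometry/Resolution`. Scheme-theoretic form of
`StrictNormalCrossingsOpen.lean` (ring level, `IsSNCIdeal.exists_notMem_forall`): on a scheme
locally of finite type over a perfect field, the pointwise strict normal crossings condition
(`IsStrictNormalCrossingsAt`, Stacks 0BI9 at a point) for a closed subset `Z` at a point
`p ∈ Z` holds at every point of `Z` in an open neighbourhood of `p`. This is the step, implicit
in de Jong 1996, 4.25 (i)/4.28, from a strict normal crossings chart at one point of an étale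
neighbourhood to a strict normal crossings divisor on a (smaller) étale neighbourhood.

* `isSNCIdeal_map_iff_of_isLocalization_atPrime` — independence of the localisation model;
* `IsStrictNormalCrossingsAt.iff_isSNCIdeal_map` — on an affine open `W ∋ p`, the condition at
  `p` is the condition for `I_Z(W) · Γ(X, W)_𝔭`, `𝔭` the prime of `p`;
* `IsStrictNormalCrossingsAt.exists_mem_forall` — **openness**: some open `U ∋ p` such that the
  condition holds at all points of `U ∩ Z`; `IsStrictNormalCrossingsDivisor` on the open
  subscheme (`IsStrictNormalCrossingsAt.exists_isStrictNormalCrossingsDivisor_preimage`).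

## Sources

* A. J. de Jong, *Smoothness, semi-stability and alterations*, Publ. Math. IHÉS 83 (1996), 2.4,
  4.25–4.28.
* The Stacks Project, Tags 0BI9, 0BIA.
-/

noncomputable section

open CategoryTheory AlgebraicGeometry TopologicalSpace IsLocalRing

universe u

namespace Literature.AlgebraicGeometry.Resolution

open Scheme.IdealSheafData

/-! ## Independence of the localisation model -/

/-- Local strict normal crossings data for `I S` does not depend on the chosen localisation
`S` of `R` at the prime `𝔭`. [folklore] -/
theorem isSNCIdeal_map_iff_of_isLocalization_atPrime {R : Type u} [CommRing R] (𝔭 : Ideal R)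
    [𝔭.IsPrime] (S S' : Type u) [CommRing S] [CommRing S'] [Algebra R S] [Algebra R S']
    [IsLocalization.AtPrime S 𝔭] [IsLocalization.AtPrime S' 𝔭] (I : Ideal R) :
    haveI := IsLocalization.AtPrime.isLocalRing S 𝔭
    haveI := IsLocalization.AtPrime.isLocalRing S' 𝔭
    IsSNCIdeal (I.map (algebraMap R S)) ↔ IsSNCIdeal (I.map (algebraMap R S')) := by
  haveI := IsLocalization.AtPrime.isLocalRing S 𝔭
  haveI := IsLocalization.AtPrime.isLocalRing S' 𝔭
  let e := (IsLocalization.algEquiv 𝔭.primeCompl S S').toRingEquiv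
  have he : (e : S →+* S').comp (algebraMap R S) = algebraMap R S' :=
    RingHom.ext fun r => (IsLocalization.algEquiv 𝔭.primeCompl S S').commutes r
  rw [IsSNCIdeal.iff_of_ringEquiv e, Ideal.map_map, he]

/-! ## The condition at a point, on an affine chart -/

section Chart

variable {X : Scheme.{u}} {Z : Set X} {W : X.Opens} (hW : IsAffineOpen W) {p : X}
  (hpW : p ∈ W)

/-- On an affine open `W ∋ p`, the strict normal crossings condition for `Z` at `p` is the ring
condition for the extension of `I_Z(W) ⊆ Γ(X, W)` to the localisation at the prime `𝔭` of `p`.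
[folklore] -/
theorem IsStrictNormalCrossingsAt.iff_isSNCIdeal_map :
    IsStrictNormalCrossingsAt X Z p ↔
      IsSNCIdeal (((vanishingIdeal ⟨closure Z, isClosed_closure⟩).ideal ⟨W, hW⟩).map
        (algebraMap Γ(X, W) (Localization.AtPrime (hW.primeIdealOf ⟨p, hpW⟩).asIdeal))) := by
  letI := TopCat.Presheaf.algebra_section_stalk X.presheaf (⟨p, hpW⟩ : W)
  haveI := hW.isLocalization_stalk ⟨p, hpW⟩
  unfold IsStrictNormalCrossingsAt
  rw [stalkIdeal_eq_map_germ _ ⟨W, hW⟩ hpW,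
    ← isSNCIdeal_map_iff_of_isLocalization_atPrime (hW.primeIdealOf ⟨p, hpW⟩).asIdeal
      (X.presheaf.stalk p)]
  rfl

/-- Membership in the basic open `D(g)` in terms of the prime of the point. [folklore] -/
theorem mem_basicOpen_iff_notMem_primeIdealOf (g : Γ(X, W)) :
    p ∈ X.basicOpen g ↔ g ∉ (hW.primeIdealOf ⟨p, hpW⟩).asIdeal := by
  letI := TopCat.Presheaf.algebra_section_stalk X.presheaf (⟨p, hpW⟩ : W)
  haveI := hW.isLocalization_stalk ⟨p, hpW⟩
  rw [X.mem_basicOpen g p hpW]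
  exact IsLocalization.AtPrime.isUnit_to_map_iff (X.presheaf.stalk p)
    (hW.primeIdealOf ⟨p, hpW⟩).asIdeal g

/-- The sections of the ideal sheaf of (the closure of) `Z` over `W` lie in the prime of every
point of `W ∩ Z`. [folklore] -/
theorem vanishingIdeal_ideal_le_primeIdealOf (hp : p ∈ Z) :
    (vanishingIdeal ⟨closure Z, isClosed_closure⟩).ideal ⟨W, hW⟩ ≤
      (hW.primeIdealOf ⟨p, hpW⟩).asIdeal := by
  intro s hs
  rw [vanishingIdeal_ideal] at hs
  refine (PrimeSpectrum.mem_vanishingIdeal _ _).mp hs (hW.primeIdealOf ⟨p, hpW⟩) ?_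
  change hW.fromSpec (hW.primeIdealOf ⟨p, hpW⟩) ∈ closure Z
  rw [hW.fromSpec_primeIdealOf ⟨p, hpW⟩]
  exact subset_closure hp

end Chart

/-! ## Openness -/

/-- **The strict normal crossings condition is open** (schemes locally of finite type over a
perfect field): if a subset `Z ⊆ X` satisfies the condition at `p`, then at all
points of `Z` in some open neighbourhood of `p`. Proof: on an affine open `W ∋ p` the coordinate
ring is of finite type over the perfect field, and `IsSNCIdeal.exists_notMem_forall` provides
`g ∉ 𝔭` such that the condition holds at every prime `𝔮 ∌ g` containing `I_Z(W)`; take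
`U = D(g)`. [folklore] -/
theorem IsStrictNormalCrossingsAt.exists_mem_forall {k : Type u} [Field k] [PerfectField k]
    {X : Scheme.{u}} (f : X ⟶ Spec (.of k)) [LocallyOfFiniteType f] {Z : Set X} {p : X}
    (h : IsStrictNormalCrossingsAt X Z p) :
    ∃ U : X.Opens, p ∈ U ∧ ∀ q ∈ U, q ∈ Z → IsStrictNormalCrossingsAt X Z q := by
  obtain ⟨W, hW, hpW, -⟩ := exists_isAffineOpen_mem_and_subset (X := X) (x := p) (U := ⊤) trivial
  -- `Γ(X, W)` is of finite type over the perfect field `k`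
  have hft : RingHom.FiniteType (f.appLE ⊤ W le_top).hom :=
    HasRingHomProperty.appLE @LocallyOfFiniteType f inferInstance ⟨⊤, isAffineOpen_top _⟩
      ⟨W, hW⟩ le_top
  let φ : k →+* Γ(X, W) := (f.appLE ⊤ W le_top).hom.comp (Scheme.ΓSpecIso (.of k)).inv.hom
  have hφ : φ.FiniteType :=
    hft.comp (RingHom.FiniteType.of_surjective _
      (Scheme.ΓSpecIso (.of k)).commRingCatIsoToRingEquiv.symm.surjective)
  letI : Algebra k Γ(X, W) := φ.toAlgebra
  haveI : Algebra.FiniteType k Γ(X, W) := hφ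
  -- the ring statement at the prime of `p`
  set I₀ := (vanishingIdeal ⟨closure Z, isClosed_closure⟩).ideal ⟨W, hW⟩ with hI₀
  have h' := (IsStrictNormalCrossingsAt.iff_isSNCIdeal_map hW hpW).mp h
  obtain ⟨g, hg, hforall⟩ :=
    IsSNCIdeal.exists_notMem_forall k I₀ (hW.primeIdealOf ⟨p, hpW⟩).asIdeal h'
  refine ⟨X.basicOpen g, (mem_basicOpen_iff_notMem_primeIdealOf hW hpW g).mpr hg,
    fun q hqU hqZ => ?_⟩
  have hqW : q ∈ W := X.basicOpen_le g hqU
  have hgq : g ∉ (hW.primeIdealOf ⟨q, hqW⟩).asIdeal :=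
    (mem_basicOpen_iff_notMem_primeIdealOf hW hqW g).mp hqU
  exact (IsStrictNormalCrossingsAt.iff_isSNCIdeal_map hW hqW).mpr
    (hforall _ hgq (vanishingIdeal_ideal_le_primeIdealOf hW hqW hqZ))

/-- **A strict normal crossings divisor near a point where the condition holds**: for `Z`
closed satisfying the strict normal crossings condition at a point `p` (on a scheme locally of
finite type over a perfect field), there is an open `U ∋ p` such that `Z ∩ U` is a strict normal
crossings divisor in the open subscheme `U`. [folklore] -/
theorem IsStrictNormalCrossingsAt.exists_isStrictNormalCrossingsDivisor_preimage {k : Type u}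
    [Field k] [PerfectField k] {X : Scheme.{u}} (f : X ⟶ Spec (.of k)) [LocallyOfFiniteType f]
    {Z : Set X} (hZ : IsClosed Z) {p : X} (h : IsStrictNormalCrossingsAt X Z p) :
    ∃ U : X.Opens, p ∈ U ∧ IsStrictNormalCrossingsDivisor U (U.ι ⁻¹' Z) := by
  obtain ⟨U, hpU, hU⟩ := h.exists_mem_forall f
  refine ⟨U, hpU, IsStrictNormalCrossingsDivisor.of_forall_isStrictNormalCrossingsAt
    (hZ.preimage U.ι.continuous) fun y hy => ?_⟩
  rw [← IsStrictNormalCrossingsAt.iff_of_isOpenImmersion U.ι hZ y]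
  exact hU (U.ι y) (by simp) hy

end Literature.AlgebraicGeometry.Resolution

end
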